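/-
Copyright (c) 2026 the pub-hodgecm-mathlib formalisation cell (harness21).  Prover seat hodgecm-mathlib-B-p14 (g37): road «S3-tree» (LEAD F0P3a-plan (g12); architect A-p16 (g30),
census «S3-tree» v4 §3 row «ramified valencies (S3-res capital)»), brick T1 «the `U(3)_v` tree», DATUM-FREE EDITION R5d = THE FRAMES `hfr₀`, `hfr₂` FROM TRANSITIVITY AND THE
ANY-INVOLUTION CARTAN DECOMPOSITION; the tame-ramified lattice graph is a TREE and its spheres are counted UNCONDITIONALLY; 2026-09-01.
-/
import Literature.NumberTheory.Automorphic.UnitaryLatticeTreeIsTreeOfInvolution     -- ★ T1 R5c (B-p14 (g36)): `isTree_latticeGraph_three_of_frames (hσ) (hvσ) (hϖ) (hfr₀) (hfr₂)`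
import Literature.NumberTheory.Automorphic.UnitaryLatticeTreeValencyRamified        -- ★ T1e R4 (B-p14 (g36)): `ncard_sphere_of_ramified (hT)`; brings ★ `forall_isVertexLattice_two_exists_mapGL_N₁_eq_of_neg` (F0P3a-p07)
import Literature.NumberTheory.Automorphic.UnitaryLatticeTreeSelfDualTransitiveTame  -- ★ T1e (B-p14 (g36)): `exists_unitary_mapGL_stdLattice_eq_of_isSelfDualLattice_of_v_two` (`htr₀` at `|2| = 1`)
import Literature.NumberTheory.Automorphic.UnitaryGroupRankOneCartanAnyInvolution   -- ★ (B-p17 (g21)): Iwasawa `exists_glInt_mul_borel`, `exists_unipotent_mul_torus_eq`, the ray `coe_pow_eq_diagonal`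
import Literature.NumberTheory.Automorphic.UnitaryThreeDoubleCosetsHK              -- ★ `UnitaryGroup.mem_unitaryInt_iff_forall_v_apply_le_one` (the `K₀` bridge `glInt ↔ unitaryInt`)
import HarnessLib

/-!
# The lattice graph of a hermitian space — T1 FILE R5d: THE FRAMES OF THE VERTICES FROM TRANSITIVITY AND THE CARTAN DECOMPOSITION FOR ANY ISOMETRIC INVOLUTION;
# THE TAME-RAMIFIED `U(3)` LATTICE GRAPH IS A TREE (Bruhat–Tits 1972 §10, (4.4.3); Tits 1979 §2.4, §3.3.3; Serre *Trees* II.1.1)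

Topic `NumberTheory/Automorphic`; namespaces `Literature.NumberTheory.Automorphic.UnitaryGroup` (§1) and `Literature.NumberTheory.Automorphic.UnitaryLatticeTree` (§2–§4).
THEOREMS ONLY (no definition, no instance, no notation, no named fact, no `sorry`); kernel lane.  Cell `pub/hodgecm-mathlib` (D-0151), crux H413 = `stmt-HodgeConjecture-24833`;
road «S3-tree», brick T1 «the `U(3)_v` lattice graph is a TREE», DATUM-FREE EDITION, file 4 (after ★ R5a, R5b, R5c).  ★ R5c `isTree_latticeGraph_three_of_frames` proves tree-ness
for ANY involution `σ` preserving `v` and ANY uniformiser `ϖ` GIVEN THE FRAMES: `hfr₀` = every self-dual vertex is `κ · latt diag(ϖ^a, 1, ϖ^{−a})` (`κ ∈ K₀`, `a : ℤ`), `hfr₂` = every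
type-two vertex is `κ · t · κ″ · N₁` (`κ, κ″ ∈ K₀`, `t = diag(ϖ^a, 1, (σϖ)^{−a}) ∈ U`, `a : ℕ`, `N₁ = latt diag(1, 1, ϖ)`).  HERE the frames are DERIVED from the transitivity of
`U = U(σ, J₀)` on the two vertex types (`htr₀`, `htr₂`) and the CARTAN DECOMPOSITION `U = K₀ · a^ℕ · K₀` for the ray `a = diag(ϖ, 1, (σϖ)⁻¹)` of ★ `UnitaryGroupRankOneCartanAnyInvolution`
(any isometric involution, ramified quadratic `K/K^σ` and residue characteristic `2` included).  The packaged ★ `exists_cartan_of_involution` carries an opaque CENTRAL factor `z`;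
§1 re-derives the decomposition WITHOUT it (`z = d₁ · 1` is a unit scalar, hence in `K₀`): the torus step is done directly — `diag(d₀, d₁, d₂) = a^p · diag(u, d₁, (σu)⁻¹)` when
`|d₀| ≤ 1` (`d₀ = ϖ^p u`), and a `w₀`-flip when `|d₀| > 1`.  CONSEQUENCES: `isTree_latticeGraph_three_of_transitive (htr₀) (htr₂)`; at a TAMELY RAMIFIED place
(`σϖ = −ϖ`, `σ` residually trivial, `|2| = 1`, first-order norm surjectivity `hnorm`) both transitivity binders are ★ (`exists_unitary_mapGL_stdLattice_eq_of_isSelfDualLattice_of_v_two`,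
F0P3a-p07's `forall_isVertexLattice_two_exists_mapGL_N₁_eq_of_neg`), so THE TAME-RAMIFIED LATTICE GRAPH IS A TREE with no tree binder, and the sphere counts of ★ R4
(`ncard_sphere_of_ramified (hT)`) become unconditional: `#S_m(r) = (q + 1) q^{m−1}`.

* §1 (`UnitaryGroup`, `[Valued K ℤᵐ⁰] [ValuativeRel K] [Valued.v.Compatible]`) `v_eq_one_of_map_mul_self_eq_one`; **`exists_eq_pow_mul_glInt_of_mem_torusU`** (`t ∈ T`, `|t₀₀| ≤ 1`
  ⇒ `t = a^p · k`, `k ∈ K₀`); **`exists_torus_eq_glInt_mul_pow_mul_glInt`** (`T ⊂ K₀ · a^ℕ · K₀`); **`exists_glInt_mul_pow_mul_glInt`** (`U = K₀ · a^ℕ · K₀`, no central factor).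
* §2 (`UnitaryLatticeTree`) `mem_unitaryInt_of_coe_mem_glInt` (bridge); **`exists_frame_mapGL_stdLattice`** (`u · 𝒪³ = κ · latt diag(ϖ^a, 1, ϖ^{−a})`, `κ ∈ K₀`, `a : ℤ`);
  **`exists_frame_mapGL_N₁`** (`u · N₁ = κ · a^p · κ″ · N₁`).
* §3 **`isTree_latticeGraph_three_of_transitive (hσ) (hvσ) (hϖ) (htr₀) (htr₂)`**.
* §4 **`isTree_latticeGraph_three_of_neg (hσ) (hvσ) (hϖ) (hσϖ) (hres) (h2) (hnorm)`** — the tame-ramified tree; **`ncard_sphere_of_neg`** (`(q+1) q^{m−1}`), `ncard_sphere_two_of_neg` (`q² + q`).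

HONEST LABEL: HC_CM is proved only modulo the 2 remaining named inputs (hLiu418 24832, h413 24833) until rung 0 closes; nothing printed is asserted here (elementary matrix algebra over a
valued field + the cited ★ tree files); ramified places belong to the residue letter S3-res and this file discharges no letter by itself.

## References
* [BruhatTits1972] F. Bruhat, J. Tits, *Groupes réductifs sur un corps local I*, Publ. Math. IHÉS 41 (1972), (4.4.3) (Cartan decomposition `G = K A⁺ K`), §10.
* [Tits1979] J. Tits, *Reductive groups over local fields*, PSPM 33.1 (1979), §2.4 (ramified quasi-split `U(3)`: local index `(q+1, q+1)`), §3.3.3.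
* [Serre1980Trees] J.-P. Serre, *Trees* (1980), Ch. II §1.1; Ch. I §2.3 (spheres of a regular tree).
* [Rogawski1990] J. D. Rogawski, *Automorphic Representations of Unitary Groups in Three Variables*, Ann. of Math. Stud. 123 (1990), §1.10 p. 9 (`B = MN`, `d(α, β, ᾱ⁻¹)`, `w₀`).
* [Jacobowitz1962] R. Jacobowitz, *Hermitian forms over local fields*, Amer. J. Math. 84 (1962), §7–§8 (transitivity on lattices of a given Jordan type).
-/

set_option autoImplicit false

noncomputable section

open scoped Valued WithZero Matrix MatrixGroups

namespace Literature.NumberTheory.Automorphic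

/-! ## §1 The Cartan decomposition `U(σ, Φ₃) = K₀ · a^ℕ · K₀` WITHOUT a central factor -/

namespace UnitaryGroup

section Cartan

variable {K : Type*} [Field K] [Valued K ℤᵐ⁰] [ValuativeRel K] [(Valued.v : Valuation K ℤᵐ⁰).Compatible]
  (σ : K →+* K) {J : Matrix (Fin 3) (Fin 3) K} (hJ : J = (StdForm.antidiagonal 3).over K) {ϖ : K}

omit [Valued K ℤᵐ⁰] [ValuativeRel K] [(Valued.v : Valuation K ℤᵐ⁰).Compatible] in
/-- A `3 × 3` diagonal matrix written out (private copy of the ★ Cartan file's helper). [folklore] -/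
private theorem diagonal_three_eq_R5d (p q r : K) : Matrix.diagonal ![p, q, r] = !![p, 0, 0; 0, q, 0; 0, 0, r] := by
  ext i j
  fin_cases i <;> fin_cases j <;> simp

omit [ValuativeRel K] [(Valued.v : Valuation K ℤᵐ⁰).Compatible] in
/-- **Norm-one elements are units**: `σ x · x = 1` with `σ` isometric forces `|x| = 1` (`|x|² = 1` in the value group `ℤ`). [cite: Serre1979, Ch. II §1] -/
theorem v_eq_one_of_map_mul_self_eq_one (hσv : ∀ x, Valued.v (σ x) = Valued.v x) {x : K} (hx : σ x * x = 1) : Valued.v x = 1 := by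
  have hx0 : x ≠ 0 := fun h => by rw [h, mul_zero] at hx; exact zero_ne_one hx
  obtain ⟨m, hm⟩ : ∃ m : ℤ, Valued.v x = WithZero.exp m := ⟨_, (WithZero.exp_log ((Valuation.ne_zero_iff _).2 hx0)).symm⟩
  have hv : Valued.v x * Valued.v x = 1 := by
    calc Valued.v x * Valued.v x = Valued.v (σ x) * Valued.v x := by rw [hσv]
      _ = 1 := by rw [← map_mul, hx, map_one]
  rw [hm, ← WithZero.exp_add, ← WithZero.exp_zero, WithZero.exp_inj] at hv
  rw [hm, show m = 0 by omega, WithZero.exp_zero]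

include hJ in
/-- **A torus element with integral leading entry lies on the positive ray up to `K₀`**: for `t = diag(d₀, d₁, d₂) ∈ T` with `|d₀| ≤ 1`, writing `d₀ = ϖ^p u` (`|u| = 1`),
`t = a^p · diag(u, d₁, (σu)⁻¹)` with the second factor in `K₀` (`|d₁| = 1` by `σd₁ d₁ = 1`, and `d₂ = (σd₀)⁻¹ = (σϖ)⁻ᵖ (σu)⁻¹`).
[cite: BruhatTits1972, (4.4.3)] [cite: Rogawski1990, §1.10 p. 9] -/
theorem exists_eq_pow_mul_glInt_of_mem_torusU (hσσ : ∀ x, σ (σ x) = x) (hσv : ∀ x, Valued.v (σ x) = Valued.v x)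
    (hϖ : Valued.v ϖ = WithZero.exp (-1 : ℤ))
    (a : ↥(unitaryGroupOfForm σ J)) (ha : ((a : GL (Fin 3) K) : Matrix (Fin 3) (Fin 3) K) = Matrix.diagonal ![ϖ, 1, (σ ϖ)⁻¹])
    {t : ↥(unitaryGroupOfForm σ J)} (ht : t ∈ torusU σ J) (ht0 : Valued.v ((((t : GL (Fin 3) K) : Matrix (Fin 3) (Fin 3) K)) 0 0) ≤ 1) :
    ∃ k ∈ (glInt 3 K).comap (unitaryGroupOfForm σ J).subtype, ∃ p : ℕ, t = a ^ p * k := by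
  have hϖ0 : ϖ ≠ 0 := CartanUnique.uniformizer_ne_zero hϖ
  obtain ⟨d, htM, -, hd11, hd02⟩ := exists_coe_eq_diagonal_of_mem_torusU σ hJ ht
  have hd0 : (((t : GL (Fin 3) K) : Matrix (Fin 3) (Fin 3) K)) 0 0 = d 0 := by rw [htM, Matrix.diagonal_apply_eq]
  rw [hd0] at ht0
  obtain ⟨p, hp⟩ := CartanUnique.exists_v_eq_exp_neg (d 0).ne_zero ht0
  -- the unit `u = d₀ ϖ^{-p}`
  have hϖp : ϖ ^ p ≠ 0 := pow_ne_zero _ hϖ0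
  set u : K := (d 0 : K) * (ϖ ^ p)⁻¹ with hu
  have hvu : Valued.v u = 1 := by
    rw [hu, map_mul, map_inv₀, CartanUnique.v_uniformizer_pow hϖ, hp, ← WithZero.exp_neg, ← WithZero.exp_add, neg_neg,
      neg_add_cancel, WithZero.exp_zero]
  have hu0 : u ≠ 0 := fun h => by rw [h, map_zero] at hvu; exact zero_ne_one hvu
  have hd1 : Valued.v (d 1 : K) = 1 := v_eq_one_of_map_mul_self_eq_one σ hσv hd11
  obtain ⟨ku, -, hku⟩ := exists_coe_eq_diag σ hJ hσσ hu0 hd11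
  have hkuK : (ku : GL (Fin 3) K) ∈ glInt 3 K := by
    refine mem_glInt_of_coe_eq σ hJ hσv hku fun i j => ?_
    fin_cases i <;> fin_cases j <;> simp [hvu, hσv, hd1]
  refine ⟨ku, hkuK, p, ?_⟩
  -- the scalar identities `d₀ = ϖ^p u`, `d₂ = (σϖ)⁻ᵖ (σu)⁻¹`
  have h0 : (d 0 : K) = ϖ ^ p * u := by rw [hu]; field_simp
  have hd2 : (d 2 : K) = (σ (d 0 : K))⁻¹ := eq_inv_of_mul_eq_one_right hd02
  have h2 : (d 2 : K) = (σ ϖ)⁻¹ ^ p * (σ u)⁻¹ := by rw [hd2, h0, map_mul, map_pow, mul_inv, inv_pow]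
  apply Subtype.ext
  apply Units.ext
  rw [Subgroup.coe_mul, Units.val_mul, htM, coe_pow_eq_diagonal σ a ha, hku, diagonal_three_eq_R5d]
  simp only [Matrix.mul_fin_three]
  ext i j
  fin_cases i <;> fin_cases j <;> simp [h0, h2]

include hJ in
/-- **`T ⊂ K₀ · a^ℕ · K₀`** (no central factor): if `|t₀₀| ≤ 1` this is `exists_eq_pow_mul_glInt_of_mem_torusU` with `k₁ = 1`; otherwise `w₀ t w₀ = diag(d₂, d₁, d₀) ∈ T` has
`|d₂| = |d₀|⁻¹ < 1`, so `w₀ t w₀ = a^p k` and `t = w₀ · a^p · (k w₀)` (`w₀ ∈ K₀`). [cite: BruhatTits1972, (4.4.3)] [cite: Rogawski1990, §1.10 p. 9] -/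
theorem exists_torus_eq_glInt_mul_pow_mul_glInt (hσσ : ∀ x, σ (σ x) = x) (hσv : ∀ x, Valued.v (σ x) = Valued.v x)
    (hϖ : Valued.v ϖ = WithZero.exp (-1 : ℤ))
    (a : ↥(unitaryGroupOfForm σ J)) (ha : ((a : GL (Fin 3) K) : Matrix (Fin 3) (Fin 3) K) = Matrix.diagonal ![ϖ, 1, (σ ϖ)⁻¹])
    {t : ↥(unitaryGroupOfForm σ J)} (ht : t ∈ torusU σ J) :
    ∃ k₁ ∈ (glInt 3 K).comap (unitaryGroupOfForm σ J).subtype, ∃ k₂ ∈ (glInt 3 K).comap (unitaryGroupOfForm σ J).subtype,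
      ∃ p : ℕ, t = k₁ * a ^ p * k₂ := by
  by_cases ht0 : Valued.v ((((t : GL (Fin 3) K) : Matrix (Fin 3) (Fin 3) K)) 0 0) ≤ 1
  · obtain ⟨k, hk, p, h⟩ := exists_eq_pow_mul_glInt_of_mem_torusU σ hJ hσσ hσv hϖ a ha ht ht0
    exact ⟨1, Subgroup.one_mem _, k, hk, p, by rw [one_mul]; exact h⟩
  rw [not_le] at ht0
  obtain ⟨d, htM, -, -, hd02⟩ := exists_coe_eq_diagonal_of_mem_torusU σ hJ ht
  have hd0 : (((t : GL (Fin 3) K) : Matrix (Fin 3) (Fin 3) K)) 0 0 = d 0 := by rw [htM, Matrix.diagonal_apply_eq]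
  rw [hd0] at ht0
  -- the flipped torus element `t' = w₀ t w₀ = diag(d₂, d₁, d₀)`
  have htM' : (((t : GL (Fin 3) K) : Matrix (Fin 3) (Fin 3) K)) = !![(d 0 : K), 0, 0; 0, (d 1 : K), 0; 0, 0, (d 2 : K)] := by
    rw [htM]
    ext i j
    fin_cases i <;> fin_cases j <;> simp
  set t' : ↥(unitaryGroupOfForm σ J) := weylLongU σ hJ * t * weylLongU σ hJ with ht'
  have ht'M : (((t' : GL (Fin 3) K) : Matrix (Fin 3) (Fin 3) K)) = !![(d 2 : K), 0, 0; 0, (d 1 : K), 0; 0, 0, (d 0 : K)] := by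
    rw [ht', Subgroup.coe_mul, Subgroup.coe_mul, Units.val_mul, Units.val_mul, coe_coe_weylLongU_three σ hJ, htM']
    simp only [Matrix.mul_fin_three]
    ext i j
    fin_cases i <;> fin_cases j <;> simp
  have ht'T : t' ∈ torusU σ J := by
    refine (mem_torusU_iff _).2 ⟨![d 2, d 1, d 0], Units.ext ?_⟩
    rw [coe_glDiagonal, ht'M]
    ext i j
    fin_cases i <;> fin_cases j <;> simp
  -- `|d₂| = |d₀|⁻¹ ≤ 1`
  have hprod : Valued.v (d 0 : K) * Valued.v (d 2 : K) = 1 := by rw [← hσv (d 0 : K), ← map_mul, hd02, map_one]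
  have hv2 : Valued.v (d 2 : K) ≤ 1 := by
    rw [eq_inv_of_mul_eq_one_right hprod, inv_le_one₀ (zero_lt_one.trans ht0)]
    exact ht0.le
  have ht'0 : Valued.v ((((t' : GL (Fin 3) K) : Matrix (Fin 3) (Fin 3) K)) 0 0) ≤ 1 := by
    rw [ht'M]; simpa using hv2
  obtain ⟨k, hk, p, h⟩ := exists_eq_pow_mul_glInt_of_mem_torusU σ hJ hσσ hσv hϖ a ha ht'T ht'0
  refine ⟨weylLongU σ hJ, weylLongU_mem_comap_glInt σ hJ, k * weylLongU σ hJ,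
    Subgroup.mul_mem _ hk (weylLongU_mem_comap_glInt σ hJ), p, ?_⟩
  have hww := weylLongU_mul_weylLongU σ hJ
  calc t = (weylLongU σ hJ * weylLongU σ hJ) * t * (weylLongU σ hJ * weylLongU σ hJ) := by rw [hww, one_mul, mul_one]
    _ = weylLongU σ hJ * t' * weylLongU σ hJ := by rw [ht']; simp only [mul_assoc]
    _ = weylLongU σ hJ * (a ^ p * k) * weylLongU σ hJ := by rw [h]
    _ = weylLongU σ hJ * a ^ p * (k * weylLongU σ hJ) := by simp only [mul_assoc]

include hJ in
/-- **THE CARTAN DECOMPOSITION WITHOUT CENTRAL FACTOR: `U(σ, Φ₃) = K₀ · a^ℕ · K₀`** for ANY isometric involution `σ` and ANY uniformiser `ϖ`, `a = diag(ϖ, 1, (σϖ)⁻¹)`: every `g ∈ U` is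
`k₁ a^p k₂` with `k₁, k₂ ∈ K₀ = U ∩ GL₃(𝒪)`.  Iwasawa `g = k (n t)` (★ `exists_glInt_mul_borel`, ★ `exists_unipotent_mul_torus_of_mem_borelOfForm`), `n t ∈ K₀ T K₀` (★
`exists_unipotent_mul_torus_eq`) and `T ⊂ K₀ a^ℕ K₀` (`exists_torus_eq_glInt_mul_pow_mul_glInt`) — the ★ `exists_cartan_of_involution` argument with the centre absorbed.
[cite: BruhatTits1972, (4.4.3)] [cite: Tits1979, §3.3.3] [cite: Rogawski1990, §1.10 p. 9] -/
theorem exists_glInt_mul_pow_mul_glInt (hσσ : ∀ x, σ (σ x) = x) (hσv : ∀ x, Valued.v (σ x) = Valued.v x)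
    (hϖ : Valued.v ϖ = WithZero.exp (-1 : ℤ))
    (a : ↥(unitaryGroupOfForm σ J)) (ha : ((a : GL (Fin 3) K) : Matrix (Fin 3) (Fin 3) K) = Matrix.diagonal ![ϖ, 1, (σ ϖ)⁻¹])
    (g : ↥(unitaryGroupOfForm σ J)) :
    ∃ k₁ ∈ (glInt 3 K).comap (unitaryGroupOfForm σ J).subtype, ∃ k₂ ∈ (glInt 3 K).comap (unitaryGroupOfForm σ J).subtype,
      ∃ p : ℕ, g = k₁ * a ^ p * k₂ := by
  -- Iwasawa `g = k b`
  obtain ⟨k, hk, b, hb, hgb⟩ := exists_glInt_mul_borel σ hJ hσσ hσv g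
  -- Levi `b = n t`
  obtain ⟨u, hu, d, hdT, -, hbud⟩ := exists_unipotent_mul_torus_of_mem_borelOfForm (σ := σ) (N := 3)
    ((mem_borelU_iff_mem_borelOfForm hJ b).1 hb)
  have huU : u ∈ unitaryGroupOfForm σ J := by rw [hJ]; exact hu.1
  have hdU : glDiagonal 3 K d ∈ unitaryGroupOfForm σ J := by rw [hJ]; exact hdT.1
  have hn : (⟨u, huU⟩ : ↥(unitaryGroupOfForm σ J)) ∈ unipotentU σ J := hu.2
  have ht : (⟨glDiagonal 3 K d, hdU⟩ : ↥(unitaryGroupOfForm σ J)) ∈ torusU σ J := ⟨d, rfl⟩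
  have hbnt : b = (⟨u, huU⟩ : ↥(unitaryGroupOfForm σ J)) * ⟨glDiagonal 3 K d, hdU⟩ := Subtype.ext hbud
  -- `n t ∈ K₀ T K₀` and `T ⊂ K₀ a^ℕ K₀`
  obtain ⟨k₁, hk₁, t', ht', k₂, hk₂, hnt⟩ := exists_unipotent_mul_torus_eq σ hJ hσσ hσv ht hn
  obtain ⟨k₃, hk₃, k₄, hk₄, p, ht'eq⟩ := exists_torus_eq_glInt_mul_pow_mul_glInt σ hJ hσσ hσv hϖ a ha ht'
  refine ⟨k * k₁ * k₃, Subgroup.mul_mem _ (Subgroup.mul_mem _ hk hk₁) hk₃, k₄ * k₂, Subgroup.mul_mem _ hk₄ hk₂, p, ?_⟩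
  calc g = k * (k₁ * (k₃ * a ^ p * k₄) * k₂) := by rw [hgb, hbnt, hnt, ht'eq]
    _ = k * k₁ * k₃ * a ^ p * (k₄ * k₂) := by simp only [mul_assoc]

end Cartan

end UnitaryGroup

/-! ## §2 Frames of the two vertex types from transitivity -/

namespace UnitaryLatticeTree

open Literature.NumberTheory.Automorphic Literature.NumberTheory.Automorphic.HermitianLattice
open Literature.NumberTheory.Automorphic.CartanUnique

variable {K : Type*} [Field K] [Valued K ℤᵐ⁰] [ValuativeRel K] [(Valued.v : Valuation K ℤᵐ⁰).Compatible] {σ : K →+* K} {ϖ : K}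

omit [ValuativeRel K] [(Valued.v : Valuation K ℤᵐ⁰).Compatible] in
/-- **The `K₀` bridge**: an element of `U(σ, J₀)` lying in `GL₃(𝒪)` (★ `glInt`, `ValuativeRel` currency) lies in ★ `unitaryInt σ J₀` (`Valued` currency) — both say «all entries
are integral» when `σ` preserves `v`. [cite: Tits1979, §3.3.3] -/
theorem mem_unitaryInt_of_coe_mem_glInt [ValuativeRel K] [(Valued.v : Valuation K ℤᵐ⁰).Compatible] (hvσ : ∀ a, Valued.v (σ a) = Valued.v a)
    {k : unitaryGroupOfForm σ ((StdForm.antidiagonal 3).over K)} (hk : (k : GL (Fin 3) K) ∈ glInt 3 K) :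
    k ∈ unitaryInt σ ((StdForm.antidiagonal 3).over K) :=
  (UnitaryGroup.mem_unitaryInt_iff_forall_v_apply_le_one σ rfl hvσ k).2 ((UnitaryGroup.mem_glInt_iff_forall_v_le_one σ rfl hvσ k).1 hk)

/-- **SELF-DUAL FRAMES** (`hfr₀` from transitivity): for every `u ∈ U(σ, J₀)`, `u · 𝒪³ = κ · latt diag(ϖ^a, 1, ϖ^{−a})` with `κ ∈ K₀`, `a : ℤ` — from `u = k₁ a^p k₂`
(`exists_glInt_mul_pow_mul_glInt`), `k₂ · 𝒪³ = 𝒪³` and `a^p · 𝒪³ = latt diag(ϖ^p, 1, (σϖ)⁻ᵖ) = latt diag(ϖ^p, 1, ϖ^{−p})` (`|σϖ| = |ϖ|`, ★ `latt_diagonal_congr`).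
[cite: BruhatTits1972, (4.4.3) and §10] [cite: Tits1979, §3.3.3] -/
theorem exists_frame_mapGL_stdLattice (hσ : ∀ x, σ (σ x) = x) (hvσ : ∀ a, Valued.v (σ a) = Valued.v a) (hϖ : Valued.v ϖ = WithZero.exp (-1 : ℤ))
    (u : unitaryGroupOfForm σ ((StdForm.antidiagonal 3).over K)) :
    ∃ κ : unitaryGroupOfForm σ ((StdForm.antidiagonal 3).over K), κ ∈ unitaryInt σ ((StdForm.antidiagonal 3).over K) ∧
      ∃ a : ℤ, mapGL (u : GL (Fin 3) K) (stdLattice K 3) = mapGL (κ : GL (Fin 3) K) (latt (Matrix.diagonal ![ϖ ^ a, 1, ϖ ^ (-a)])) := by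
  have hϖ0 : ϖ ≠ 0 := uniformizer_ne_zero hϖ
  have hσϖ0 : σ ϖ ≠ 0 := (map_ne_zero σ).2 hϖ0
  obtain ⟨a, ha⟩ := UnitaryGroup.exists_coe_eq_diagonal_uniformizer σ (rfl : (StdForm.antidiagonal 3).over K = (StdForm.antidiagonal 3).over K) hσ hϖ0
  obtain ⟨k₁, hk₁, k₂, hk₂, p, hg⟩ := UnitaryGroup.exists_glInt_mul_pow_mul_glInt σ rfl hσ hvσ hϖ a ha u
  have hκ₁ : k₁ ∈ unitaryInt σ ((StdForm.antidiagonal 3).over K) := mem_unitaryInt_of_coe_mem_glInt hvσ hk₁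
  have hκ₂ : k₂ ∈ unitaryInt σ ((StdForm.antidiagonal 3).over K) := mem_unitaryInt_of_coe_mem_glInt hvσ hk₂
  refine ⟨k₁, hκ₁, (p : ℤ), ?_⟩
  rw [hg, Subgroup.coe_mul, Subgroup.coe_mul, mapGL_mul, mapGL_mul, mapGL_stdLattice_of_mem_unitaryInt hκ₂]
  congr 1
  rw [show mapGL (((a ^ p : ↥(unitaryGroupOfForm σ ((StdForm.antidiagonal 3).over K))) : GL (Fin 3) K)) (stdLattice K 3) =
      latt ((((a ^ p : ↥(unitaryGroupOfForm σ ((StdForm.antidiagonal 3).over K))) : GL (Fin 3) K)) : Matrix (Fin 3) (Fin 3) K) from rfl,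
    UnitaryGroup.coe_pow_eq_diagonal σ a ha p]
  refine latt_diagonal_congr (fun i => ?_) (fun i => ?_)
  · fin_cases i <;> simp [hϖ0, hσϖ0]
  · fin_cases i
    · simp [zpow_natCast]
    · simp
    · show Valued.v ((σ ϖ)⁻¹ ^ p) = Valued.v (ϖ ^ (-(p : ℤ)))
      rw [map_pow, map_inv₀, hvσ, ← map_inv₀, ← map_pow, inv_pow, ← zpow_natCast, ← zpow_neg]

/-- **TYPE-TWO FRAMES** (`hfr₂` from transitivity): for every `u ∈ U(σ, J₀)`, `u · N₁ = κ · t · κ″ · N₁` with `κ, κ″ ∈ K₀`, `t = a^p ∈ U` of matrix `diag(ϖ^p, 1, (σϖ)^{−p})`, `p : ℕ`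
(`N₁ = latt diag(1, 1, ϖ)` the standard type-two vertex) — `exists_glInt_mul_pow_mul_glInt` read on lattices. [cite: BruhatTits1972, (4.4.3) and §10] [cite: Tits1979, §3.3.3] -/
theorem exists_frame_mapGL_N₁ (hσ : ∀ x, σ (σ x) = x) (hvσ : ∀ a, Valued.v (σ a) = Valued.v a) (hϖ : Valued.v ϖ = WithZero.exp (-1 : ℤ))
    (u : unitaryGroupOfForm σ ((StdForm.antidiagonal 3).over K)) :
    ∃ κ : unitaryGroupOfForm σ ((StdForm.antidiagonal 3).over K), κ ∈ unitaryInt σ ((StdForm.antidiagonal 3).over K) ∧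
    ∃ κ'' : unitaryGroupOfForm σ ((StdForm.antidiagonal 3).over K), κ'' ∈ unitaryInt σ ((StdForm.antidiagonal 3).over K) ∧
    ∃ a : ℕ, ∃ t : unitaryGroupOfForm σ ((StdForm.antidiagonal 3).over K),
      ((t : GL (Fin 3) K) : Matrix (Fin 3) (Fin 3) K) = Matrix.diagonal ![ϖ ^ (a : ℤ), 1, (σ ϖ) ^ (-(a : ℤ))] ∧
      mapGL (u : GL (Fin 3) K) (latt (Matrix.diagonal ![(1 : K), 1, ϖ])) =
        mapGL (κ : GL (Fin 3) K) (mapGL (t : GL (Fin 3) K) (mapGL (κ'' : GL (Fin 3) K) (latt (Matrix.diagonal ![(1 : K), 1, ϖ])))) := by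
  have hϖ0 : ϖ ≠ 0 := uniformizer_ne_zero hϖ
  obtain ⟨a, ha⟩ := UnitaryGroup.exists_coe_eq_diagonal_uniformizer σ (rfl : (StdForm.antidiagonal 3).over K = (StdForm.antidiagonal 3).over K) hσ hϖ0
  obtain ⟨k₁, hk₁, k₂, hk₂, p, hg⟩ := UnitaryGroup.exists_glInt_mul_pow_mul_glInt σ rfl hσ hvσ hϖ a ha u
  refine ⟨k₁, mem_unitaryInt_of_coe_mem_glInt hvσ hk₁, k₂, mem_unitaryInt_of_coe_mem_glInt hvσ hk₂, p, a ^ p, ?_, ?_⟩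
  · rw [UnitaryGroup.coe_pow_eq_diagonal σ a ha p, zpow_neg, zpow_natCast, zpow_natCast, inv_pow]
  · rw [hg, Subgroup.coe_mul, Subgroup.coe_mul, mapGL_mul, mapGL_mul]

/-! ## §3 The lattice graph is a tree, from transitivity -/

/-- **THE LATTICE GRAPH OF `(K³, J₀)` IS A TREE FOR ANY ISOMETRIC INVOLUTION, GIVEN TRANSITIVITY OF `U(σ, J₀)` ON THE TWO VERTEX TYPES**: ★ R5c `isTree_latticeGraph_three_of_frames`
with its frame binders `hfr₀`, `hfr₂` discharged by `exists_frame_mapGL_stdLattice` ∕ `exists_frame_mapGL_N₁` (Cartan for any involution).  `htr₀` = every self-dual vertex is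
`u · 𝒪³`, `htr₂` = every type-two vertex is `u · N₁`. [cite: BruhatTits1972, §10] [cite: Tits1979, §3.3.3] [cite: Serre1980Trees, II.1.1] -/
theorem isTree_latticeGraph_three_of_transitive (hσ : ∀ x, σ (σ x) = x) (hvσ : ∀ a, Valued.v (σ a) = Valued.v a) (hϖ : Valued.v ϖ = WithZero.exp (-1 : ℤ))
    (htr₀ : ∀ L : Submodule 𝒪[K] (Fin 3 → K), IsSelfDualLattice σ ϖ ((StdForm.antidiagonal 3).over K) L →
      ∃ u : unitaryGroupOfForm σ ((StdForm.antidiagonal 3).over K), L = mapGL (u : GL (Fin 3) K) (stdLattice K 3))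
    (htr₂ : ∀ M : Submodule 𝒪[K] (Fin 3 → K), IsVertexLattice σ ϖ ((StdForm.antidiagonal 3).over K) 2 M →
      ∃ u : unitaryGroupOfForm σ ((StdForm.antidiagonal 3).over K), M = mapGL (u : GL (Fin 3) K) (latt (Matrix.diagonal ![(1 : K), 1, ϖ]))) :
    (latticeGraph σ ϖ ((StdForm.antidiagonal 3).over K)).IsTree := by
  refine isTree_latticeGraph_three_of_frames hσ hvσ hϖ (fun L hL => ?_) (fun M hM => ?_)
  · obtain ⟨u, rfl⟩ := htr₀ L hL
    exact exists_frame_mapGL_stdLattice hσ hvσ hϖ u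
  · obtain ⟨u, rfl⟩ := htr₂ M hM
    exact exists_frame_mapGL_N₁ hσ hvσ hϖ u

/-! ## §4 The tame-ramified `U(3)` lattice graph is a tree; its spheres -/

/-- **THE TAME-RAMIFIED `U(3)` LATTICE GRAPH IS A TREE** — no tree binder, no frame binder: `σ` an isometric involution with `σϖ = −ϖ`, residually trivial (`hres`), `|2| = 1`, and
the first-order norm surjectivity `hnorm` on `σ`-fixed one-units; `htr₀` is ★ `exists_unitary_mapGL_stdLattice_eq_of_isSelfDualLattice_of_v_two`, `htr₂` is ★
`forall_isVertexLattice_two_exists_mapGL_N₁_eq_of_neg`.  This is the Bruhat–Tits tree of the ramified quasi-split `U(3)` (both vertex types special, `(q+1)`-regular by ★ R4).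
[cite: Tits1979, §2.4] [cite: BruhatTits1972, §10] [cite: Serre1980Trees, II.1.1] [cite: Jacobowitz1962, §8] -/
theorem isTree_latticeGraph_three_of_neg (hσ : ∀ x, σ (σ x) = x) (hvσ : ∀ a, Valued.v (σ a) = Valued.v a) (hϖ : Valued.v ϖ = WithZero.exp (-1 : ℤ)) (hσϖ : σ ϖ = -ϖ)
    (hres : ∀ x : K, Valued.v x ≤ 1 → Valued.v (σ x - x) < 1) (h2 : Valued.v (2 : K) = 1)
    (hnorm : ∀ u : K, σ u = u → Valued.v (u - 1) < 1 → ∃ z : K, z * σ z = u ∧ Valued.v (z - 1) ≤ Valued.v (u - 1)) :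
    (latticeGraph σ ϖ ((StdForm.antidiagonal 3).over K)).IsTree :=
  isTree_latticeGraph_three_of_transitive hσ hvσ hϖ
    (fun _ hL => exists_unitary_mapGL_stdLattice_eq_of_isSelfDualLattice_of_v_two hσ hvσ hϖ h2 hL)
    (forall_isVertexLattice_two_exists_mapGL_N₁_eq_of_neg hσ hvσ hϖ hσϖ hres h2 hnorm)

/-- **THE SPHERES OF THE TAME-RAMIFIED `U(3)` TREE, UNCONDITIONALLY**: for EVERY vertex `r` and `m ≥ 1`, `#{v | dist(r, v) = m} = (q + 1) · q^{m−1}`, `q = |𝓀[K]|` — ★ R4 `ncard_sphere_of_ramified`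
with its tree binder `hT` discharged by `isTree_latticeGraph_three_of_neg`. [cite: Serre1980Trees, I.2.3] [cite: Tits1979, §2.4] -/
theorem ncard_sphere_of_neg (hσ : ∀ x, σ (σ x) = x) (hvσ : ∀ a, Valued.v (σ a) = Valued.v a) (hσϖ : σ ϖ = -ϖ) (hϖ : Valued.v ϖ = WithZero.exp (-1 : ℤ))
    (hres : ∀ x : K, Valued.v x ≤ 1 → Valued.v (σ x - x) < 1) (h2 : Valued.v (2 : K) = 1)
    (hnorm : ∀ u : K, σ u = u → Valued.v (u - 1) < 1 → ∃ z : K, z * σ z = u ∧ Valued.v (z - 1) ≤ Valued.v (u - 1)) [Finite 𝓀[K]]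
    (r : {M : Submodule 𝒪[K] (Fin 3 → K) // IsVertex σ ϖ ((StdForm.antidiagonal 3).over K) M}) {m : ℕ} (hm : 1 ≤ m) :
    {v | (latticeGraph σ ϖ ((StdForm.antidiagonal 3).over K)).dist r v = m}.ncard = (Nat.card 𝓀[K] + 1) * Nat.card 𝓀[K] ^ (m - 1) :=
  ncard_sphere_of_ramified hσ hvσ hσϖ hϖ hres h2 hnorm (isTree_latticeGraph_three_of_neg hσ hvσ hϖ hσϖ hres h2 hnorm) r hm

/-- **`q² + q` VERTICES AT DISTANCE `2`** from any vertex of the tame-ramified tree, unconditionally. [cite: Serre1980Trees, I.2.3] [cite: Tits1979, §2.4] -/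
theorem ncard_sphere_two_of_neg (hσ : ∀ x, σ (σ x) = x) (hvσ : ∀ a, Valued.v (σ a) = Valued.v a) (hσϖ : σ ϖ = -ϖ) (hϖ : Valued.v ϖ = WithZero.exp (-1 : ℤ))
    (hres : ∀ x : K, Valued.v x ≤ 1 → Valued.v (σ x - x) < 1) (h2 : Valued.v (2 : K) = 1)
    (hnorm : ∀ u : K, σ u = u → Valued.v (u - 1) < 1 → ∃ z : K, z * σ z = u ∧ Valued.v (z - 1) ≤ Valued.v (u - 1)) [Finite 𝓀[K]]
    (r : {M : Submodule 𝒪[K] (Fin 3 → K) // IsVertex σ ϖ ((StdForm.antidiagonal 3).over K) M}) :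
    {v | (latticeGraph σ ϖ ((StdForm.antidiagonal 3).over K)).dist r v = 2}.ncard = Nat.card 𝓀[K] ^ 2 + Nat.card 𝓀[K] :=
  ncard_sphere_two_of_ramified hσ hvσ hσϖ hϖ hres h2 hnorm (isTree_latticeGraph_three_of_neg hσ hvσ hϖ hσϖ hres h2 hnorm) r

end UnitaryLatticeTree

end Literature.NumberTheory.Automorphic

end
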